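import Literature.MathematicalPhysics.QuantumLattice.WightmanPermutedTubeSlices
import Mathlib.Analysis.Normed.Module.Connected
import Mathlib.LinearAlgebra.Complex.FiniteDimensional
import HarnessLib

/-!
# Tomozawa's connectedness theorem from the normal forms of `L₊(ℂ)`

Topic `Literature/MathematicalPhysics/QuantumLattice` (trunk T-AQFT), sequel of
`WightmanPermutedTubeSlices.lean`, in the decomposition of the named fact (K)
`IsWightmanQFT.extendedTube_continuation_perm_eq` (`WightmanPermutedTube`; OS I §5 p. 97). The file
`WightmanPermutedTubeConnected` records Tomozawa's theorem (T) `isConnected_relExtendedTube_inter_perm`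
— in four space-time dimensions every intersection `𝒯'ₙ ∩ σ𝒯'ₙ` of the extended tube with a
permuted extended tube is connected (Tomozawa, J. Math. Phys. 4 (1963) 1240: "the extended tubes,
the union of them and the intersection of any two are simply connected") — as a named fact, and
`WightmanPermutedTubeSlices` proves the preconnectedness of the slices
`{w ∈ 𝒯ʳₙ | w ∘ σ ∈ 𝒯'ₙ}` from the two classical inputs (N) `properComplexLorentz_normalForm`
(Streater–Wightman (2-87)–(2-88)) and (C) `restrictedLorentzGroup_isPathConnected`
(Streater–Wightman §1-2). Here we **derive (T) itself from (N) and (C)**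
(`isConnected_relExtendedTube_inter_perm_of_normalForm`), so that every named fact introduced in
the decomposition of (K) in four dimensions is reduced to these two textbook theorems:

* `interPerm n σ = 𝒯'ₙ ∩ σ𝒯'ₙ` is invariant under the diagonal action of `L₊(ℂ)`
  (`lorentz_mem_interPerm`) and contains the slice;
* **`L₊(ℂ)` is path-connected as acting on `𝒯'ₙ ∩ σ𝒯'ₙ`** (`joinedIn_interPerm_lorentz`): by (N),
  `Λ = R₁ M R₂`; the real factors are endpoints of paths in `L↑₊` (C) acting continuously
  (`joinedIn_interPerm_lorentzActC`), the screw `S(μ)` is reached along a path of parameters in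
  `ℂ ∖ {0}` (`joinedIn_interPerm_screw`; `isPathConnected_compl_singleton_of_one_lt_rank`), the
  null rotation along `t ↦ N(t)` (`joinedIn_interPerm_nullRot`), and `−N(1) = S(−1) N(1)`
  (`screwLin_neg_one`; Streater–Wightman §1-3: "`1` and `−1`, which are disconnected in `L` are
  connected in `L(ℂ)`");
* hence every `z = Λ₀ w₀ ∈ 𝒯'ₙ ∩ σ𝒯'ₙ` (`w₀` in the slice) is joined inside the intersection to
  `w₀`, and with the preconnected slice (`isPreconnected_permSlice_of_normalForm`) and a common
  real point (`exists_real_mem_relExtendedTube_perm`) the intersection is connected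
  (`isPreconnected_of_forall`).

Consequently (`IsWightmanQFT.extendedTube_continuation_perm_eq_dim4_of_normalForm'`) the route
through (T) and the direct route of `WightmanPermutedTubeSlices` to (K₄) coincide in their inputs.

## Sources

* Y. Tomozawa, J. Math. Phys. 4 (1963) 1240–1252, doi:10.1063/1.1703896 (Abstract).
  [Tomozawa1963]
* R. F. Streater, A. S. Wightman, *PCT, Spin and Statistics, and All That*: §1-2 (1-9), §1-3
  (the curve `Λ_t`, pdf p. 14), §2-4 (2-87)–(2-90). [StreaterWightman1964]

## Mathlib / tree

Used: `isPathConnected_compl_singleton_of_one_lt_rank`, `Complex.rank_real_complex`,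
`isPreconnected_of_forall`, `IsPreconnected.union`, `isConnected_range`, `JoinedIn.trans`; from the
tree `permSlice`, `exists_lorentz_permSlice_of_mem`, `isConnected_relExtendedTube_inter_perm`,
`IsWightmanQFT.extendedTube_continuation_perm_eq_dim4_of_isConnected`
(`WightmanPermutedTubeConnected`), `screw`, `nullRot`, `screwLin_one`, `nullRotLin_zero`,
`neg_mem_properComplexLorentzGroup`, (N), (C) (`ComplexLorentzNormalForms`), `realActC`,
`continuous_realActC`, `isPreconnected_permSlice_of_normalForm` (`WightmanPermutedTubeSlices`).
-/

noncomputable section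

namespace Literature.MathematicalPhysics.QuantumLattice

open Complex Set Filter
open _root_.Topology
open ComplexLorentz

variable {n : ℕ}

namespace ComplexLorentz

/-! ### The intersection `𝒯'ₙ ∩ σ𝒯'ₙ` is `L₊(ℂ)`-invariant -/

variable (n) in
/-- The intersection `𝒯'ₙ ∩ σ𝒯'ₙ` of the extended tube with a permuted extended tube (four
dimensions, point variables). [folklore] -/
def interPerm (σ : Equiv.Perm (Fin n)) : Set (Fin n → Fin (3 + 1) → ℂ) :=
  relExtendedTube 3 n ∩ {z | (fun k => z (σ k)) ∈ relExtendedTube 3 n}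

/-- `𝒯'ₙ ∩ σ𝒯'ₙ` is invariant under the diagonal action of `L₊(ℂ)`. [folklore] -/
theorem lorentz_mem_interPerm {σ : Equiv.Perm (Fin n)} {y : Fin n → Fin (3 + 1) → ℂ}
    (hy : y ∈ interPerm n σ) {Λ : (Fin (3 + 1) → ℂ) ≃ₗ[ℂ] (Fin (3 + 1) → ℂ)}
    (hΛ : Λ ∈ properComplexLorentzGroup 3) : (fun k => Λ (y k)) ∈ interPerm n σ :=
  ⟨lorentz_mem_relExtendedTube hy.1 hΛ, lorentz_mem_relExtendedTube hy.2 hΛ⟩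

/-- The slice lies in the intersection. [folklore] -/
theorem permSlice_subset_interPerm (σ : Equiv.Perm (Fin n)) : permSlice 3 n σ ⊆ interPerm n σ :=
  fun _ hw => ⟨relForwardTube_subset_relExtendedTube hw.1, hw.2⟩

/-! ### Joining `y` to `Λ y` inside the intersection -/

/-- **Real factors**: `y` is joined to `R y` inside `𝒯'ₙ ∩ σ𝒯'ₙ` for `R ∈ L↑₊`, along a path in
`L↑₊` from `1` to `R` given by (C). [folklore] -/
theorem joinedIn_interPerm_lorentzActC (hC : restrictedLorentzGroup_isPathConnected)
    {σ : Equiv.Perm (Fin n)} {y : Fin n → Fin (3 + 1) → ℂ} (hy : y ∈ interPerm n σ)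
    {Λ : SpaceTime 3 ≃L[ℝ] SpaceTime 3} (hΛ : Λ ∈ restrictedLorentzGroup 3) :
    JoinedIn (interPerm n σ) y (fun k => lorentzActC Λ (y k)) := by
  have h1 : ((1 : SpaceTime 3 ≃L[ℝ] SpaceTime 3) : SpaceTime 3 →L[ℝ] SpaceTime 3) ∈
      (fun R : SpaceTime 3 ≃L[ℝ] SpaceTime 3 => (R : SpaceTime 3 →L[ℝ] SpaceTime 3)) ''
        (restrictedLorentzGroup 3 : Set (SpaceTime 3 ≃L[ℝ] SpaceTime 3)) :=
    ⟨1, Subgroup.one_mem _, rfl⟩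
  have hΛ' : (Λ : SpaceTime 3 →L[ℝ] SpaceTime 3) ∈
      (fun R : SpaceTime 3 ≃L[ℝ] SpaceTime 3 => (R : SpaceTime 3 →L[ℝ] SpaceTime 3)) ''
        (restrictedLorentzGroup 3 : Set (SpaceTime 3 ≃L[ℝ] SpaceTime 3)) := ⟨Λ, hΛ, rfl⟩
  obtain ⟨γ, hγ⟩ := hC.joinedIn _ h1 _ hΛ'
  refine ⟨{ toFun := fun t => fun k => realActC (γ t) (y k),
             continuous_toFun :=
               continuous_pi fun k => (continuous_realActC (y k)).comp γ.continuous,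
             source' := ?_,
             target' := ?_ }, fun t => ?_⟩
  · funext k
    simp only [Path.source]
    rw [realActC_coe, QuantumFieldTheory.lorentzActC_one]
  · funext k
    simp only [Path.target]
    rfl
  · obtain ⟨R, hR, hRt⟩ := hγ t
    have hfun : (fun k => realActC (γ t) (y k)) = fun k => complexifyLorentz R (y k) := by
      funext k; rw [← hRt, complexifyLorentz_eq_lorentzActC]; rfl
    show (fun k => realActC (γ t) (y k)) ∈ interPerm n σ
    rw [hfun]
    exact lorentz_mem_interPerm hy (complexifyLorentz_mem_properComplexLorentzGroup_of_restricted hR)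

/-- Continuity of `(μ, ν) ↦ S(μ, ν) v`. [folklore] -/
theorem continuous_screwLin_apply (v : Fin 4 → ℂ) :
    Continuous fun p : ℂ × ℂ => screwLin p.1 p.2 v := by
  refine continuous_pi fun i => ?_
  have hp : Continuous fun p : ℂ × ℂ => (p.1 + p.2) / 2 := (continuous_fst.add continuous_snd).div_const 2
  have hm : Continuous fun p : ℂ × ℂ => (p.1 - p.2) / 2 := (continuous_fst.sub continuous_snd).div_const 2
  fin_cases i
  · exact (hp.mul continuous_const).add (hm.mul continuous_const)
  · exact (hp.mul continuous_const).sub ((continuous_const.mul hm).mul continuous_const)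
  · exact ((continuous_const.mul hm).mul continuous_const).add (hp.mul continuous_const)
  · exact (hm.mul continuous_const).add (hp.mul continuous_const)

/-- **Screws**: `y` is joined to `S(μ) y` inside `𝒯'ₙ ∩ σ𝒯'ₙ` (`μ ≠ 0`), along a path of parameters
in `ℂ ∖ {0}`. [folklore] -/
theorem joinedIn_interPerm_screw {σ : Equiv.Perm (Fin n)} {y : Fin n → Fin (3 + 1) → ℂ}
    (hy : y ∈ interPerm n σ) {μ : ℂ} (hμ : μ ≠ 0) :
    JoinedIn (interPerm n σ) y (fun k => screw μ hμ (y k)) := by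
  have hpc : IsPathConnected ({(0 : ℂ)}ᶜ : Set ℂ) :=
    isPathConnected_compl_singleton_of_one_lt_rank
      (by rw [Complex.rank_real_complex]; exact Cardinal.one_lt_two) 0
  obtain ⟨γ, hγ⟩ := hpc.joinedIn 1 (by simp) μ (by simpa using hμ)
  have hγ0 : ∀ t, γ t ≠ 0 := fun t => by simpa using hγ t
  have hcont : Continuous fun t : unitInterval => fun k => screw (γ t) (hγ0 t) (y k) := by
    refine continuous_pi fun k => ?_
    have hγc : Continuous fun t : unitInterval => ((γ t, (γ t)⁻¹) : ℂ × ℂ) :=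
      γ.continuous.prodMk (γ.continuous.inv₀ hγ0)
    exact ((continuous_screwLin_apply (y k)).comp hγc).congr fun t => rfl
  have h0 : (fun k => screw (γ 0) (hγ0 0) (y k)) = y := by
    funext k
    simp only [screw_apply, Path.source, inv_one]
    rw [screwLin_one]; rfl
  have h1 : (fun k => screw (γ 1) (hγ0 1) (y k)) = fun k => screw μ hμ (y k) := by
    funext k
    simp only [screw_apply, Path.target]
  refine ⟨{ toFun := fun t => fun k => screw (γ t) (hγ0 t) (y k),
             continuous_toFun := hcont,
             source' := h0,
             target' := h1 }, fun t => ?_⟩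
  exact lorentz_mem_interPerm hy (screw_mem_properComplexLorentzGroup (γ t) (hγ0 t))

/-- Continuity of `t ↦ N(t) v`. [folklore] -/
theorem continuous_nullRotLin_apply (v : Fin 4 → ℂ) : Continuous fun t : ℂ => nullRotLin t v := by
  refine continuous_pi fun i => ?_
  have h2 : Continuous fun t : ℂ => t / 2 := continuous_id.div_const 2
  fin_cases i
  · exact continuous_const.add (h2.mul continuous_const)
  · exact continuous_const.add (h2.mul continuous_const)
  · exact continuous_const.add ((continuous_const.mul h2).mul continuous_const)
  · exact continuous_const.add (h2.mul continuous_const)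

/-- **Null rotations**: `y` is joined to `N(1) y` inside `𝒯'ₙ ∩ σ𝒯'ₙ` along `t ↦ N(t) y`.
[folklore] -/
theorem joinedIn_interPerm_nullRot {σ : Equiv.Perm (Fin n)} {y : Fin n → Fin (3 + 1) → ℂ}
    (hy : y ∈ interPerm n σ) : JoinedIn (interPerm n σ) y (fun k => nullRot 1 (y k)) := by
  refine ⟨{ toFun := fun t => fun k => nullRotLin ((t : ℝ) : ℂ) (y k),
             continuous_toFun := continuous_pi fun k =>
               (continuous_nullRotLin_apply (y k)).comp
                 (Complex.continuous_ofReal.comp continuous_subtype_val),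
             source' := ?_,
             target' := ?_ }, fun t => ?_⟩
  · funext k
    simp only [Set.Icc.coe_zero, ofReal_zero]
    rw [nullRotLin_zero]; rfl
  · funext k
    simp only [Set.Icc.coe_one, ofReal_one]
    rfl
  · exact lorentz_mem_interPerm hy (nullRot_mem_properComplexLorentzGroup _)

/-- `S(−1) = −1`. [folklore] -/
theorem screwLin_neg_one (v : Fin 4 → ℂ) : screwLin (-1) (-1)⁻¹ v = -v := by
  refine ext_lc ?_ ?_ ?_ ?_ <;> simp

/-- **Every `Λ ∈ L₊(ℂ)` joins `y` to `Λ y` inside `𝒯'ₙ ∩ σ𝒯'ₙ`** (four dimensions, given (N) and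
(C)): `Λ = R₁ M R₂` and each factor is the endpoint of an explicit path of transformations
(`L₊(ℂ)` is path-connected "as acting on configurations"). [folklore] -/
theorem joinedIn_interPerm_lorentz (hN : properComplexLorentz_normalForm)
    (hC : restrictedLorentzGroup_isPathConnected) {σ : Equiv.Perm (Fin n)}
    {y : Fin n → Fin (3 + 1) → ℂ} (hy : y ∈ interPerm n σ)
    {Λ : (Fin (3 + 1) → ℂ) ≃ₗ[ℂ] (Fin (3 + 1) → ℂ)} (hΛ : Λ ∈ properComplexLorentzGroup 3) :
    JoinedIn (interPerm n σ) y (fun k => Λ (y k)) := by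
  obtain ⟨R₁, hR₁, R₂, hR₂, M, hM, rfl⟩ := hN Λ hΛ
  -- stage 1: `y → R₂ y`
  have hs₁ : JoinedIn (interPerm n σ) y (fun k => complexifyLorentz R₂ (y k)) := by
    simpa only [complexifyLorentz_eq_lorentzActC] using joinedIn_interPerm_lorentzActC hC hy hR₂
  have hy₂ : (fun k => complexifyLorentz R₂ (y k)) ∈ interPerm n σ :=
    lorentz_mem_interPerm hy (complexifyLorentz_mem_properComplexLorentzGroup_of_restricted hR₂)
  -- stage 2: `R₂ y → M R₂ y`
  have hMmem : M ∈ properComplexLorentzGroup 3 := by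
    rcases hM with ⟨μ, hμ0, rfl⟩ | rfl | rfl
    · exact screw_mem_properComplexLorentzGroup μ hμ0
    · exact nullRot_mem_properComplexLorentzGroup 1
    · exact Subgroup.mul_mem _ (nullRot_mem_properComplexLorentzGroup 1) neg_mem_properComplexLorentzGroup
  have hs₂ : JoinedIn (interPerm n σ) (fun k => complexifyLorentz R₂ (y k))
      (fun k => M (complexifyLorentz R₂ (y k))) := by
    rcases hM with ⟨μ, hμ0, rfl⟩ | rfl | rfl
    · exact joinedIn_interPerm_screw hy₂ hμ0
    · exact joinedIn_interPerm_nullRot hy₂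
    · -- `−N(1) = S(−1) N(1)`: first `N`, then the screw path from `1` to `−1`
      have hN₁ := joinedIn_interPerm_nullRot hy₂
      have hyN : (fun k => nullRot 1 (complexifyLorentz R₂ (y k))) ∈ interPerm n σ :=
        lorentz_mem_interPerm hy₂ (nullRot_mem_properComplexLorentzGroup 1)
      have hS := joinedIn_interPerm_screw hyN (neg_ne_zero.2 one_ne_zero)
      refine hN₁.trans ?_
      convert hS using 1
      funext k
      rw [screw_apply, screwLin_neg_one]
      simp [LinearEquiv.coe_neg]
  have hy₃ : (fun k => M (complexifyLorentz R₂ (y k))) ∈ interPerm n σ := lorentz_mem_interPerm hy₂ hMmem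
  -- stage 3: `M R₂ y → R₁ M R₂ y`
  have hs₃ : JoinedIn (interPerm n σ) (fun k => M (complexifyLorentz R₂ (y k)))
      (fun k => complexifyLorentz R₁ (M (complexifyLorentz R₂ (y k)))) := by
    simpa only [complexifyLorentz_eq_lorentzActC] using joinedIn_interPerm_lorentzActC hC hy₃ hR₁
  simpa only [LinearEquiv.mul_apply] using hs₁.trans (hs₂.trans hs₃)

end ComplexLorentz

/-! ### Tomozawa's theorem from (N) and (C) -/

/-- **(N) + (C) ⇒ Tomozawa's connectedness theorem.** In four space-time dimensions every
intersection `𝒯'ₙ ∩ σ𝒯'ₙ` is connected (`isConnected_relExtendedTube_inter_perm`, Tomozawa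
(1963)): it is non-empty (common real points, Streater–Wightman Fig. 2-4), every point `z = Λ₀ w₀`
of it is joined inside it to a point `w₀` of the slice `{w ∈ 𝒯ʳₙ | w ∘ σ ∈ 𝒯'ₙ}`
(`joinedIn_interPerm_lorentz`), and the slice is preconnected
(`isPreconnected_permSlice_of_normalForm`). [folklore] -/
theorem isConnected_relExtendedTube_inter_perm_of_normalForm
    (hN : ComplexLorentz.properComplexLorentz_normalForm)
    (hC : ComplexLorentz.restrictedLorentzGroup_isPathConnected) :
    isConnected_relExtendedTube_inter_perm := by
  intro n σ
  change IsConnected (interPerm n σ)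
  -- a point of the slice
  obtain ⟨x, hx, hxσ⟩ := exists_real_mem_relExtendedTube_perm (m := 1) (n := n) σ
  obtain ⟨Λ₁, -, w₁, hw₁, -⟩ := exists_lorentz_permSlice_of_mem σ hx hxσ
  refine ⟨⟨_, ⟨hx, hxσ⟩⟩, isPreconnected_of_forall w₁ fun z hz => ?_⟩
  obtain ⟨Λ₀, hΛ₀, w₀, hw₀, rfl⟩ := exists_lorentz_permSlice_of_mem σ hz.1 hz.2
  obtain ⟨γ, hγ⟩ := joinedIn_interPerm_lorentz hN hC (permSlice_subset_interPerm σ hw₀) hΛ₀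
  refine ⟨Set.range γ ∪ permSlice 3 n σ, union_subset (range_subset_iff.2 hγ) (permSlice_subset_interPerm σ),
    Or.inr hw₁, Or.inl ⟨1, γ.target⟩, ?_⟩
  exact IsPreconnected.union w₀ ⟨0, γ.source⟩ hw₀
    (isConnected_range γ.continuous).isPreconnected (isPreconnected_permSlice_of_normalForm hN hC σ)

/-- **(N) + (C) ⇒ (K₄), through Tomozawa's theorem** (the same conclusion as
`IsWightmanQFT.extendedTube_continuation_perm_eq_dim4_of_normalForm`, routed through the named fact
of `WightmanPermutedTubeConnected`). [folklore] -/
theorem IsWightmanQFT.extendedTube_continuation_perm_eq_dim4_of_normalForm' {κ : Type*}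
    (hN : ComplexLorentz.properComplexLorentz_normalForm)
    (hC : ComplexLorentz.restrictedLorentzGroup_isPathConnected) :
    IsWightmanQFT.extendedTube_continuation_perm_eq_dim4 (κ := κ) :=
  IsWightmanQFT.extendedTube_continuation_perm_eq_dim4_of_isConnected
    (isConnected_relExtendedTube_inter_perm_of_normalForm hN hC)

end Literature.MathematicalPhysics.QuantumLattice
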